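import Literature.MathematicalPhysics.QuantumLattice.HubbardSectorCovariance
import Literature.MathematicalPhysics.QuantumLattice.HubbardSpaceTimeCharacters
import HarnessLib

/-!
# The sectorised single-scale covariance of the BGM instance: entries as product-symbol character sums

Topic `MathematicalPhysics/QuantumLattice`.  Benfatto–Giuliani–Mastropietro 2006, §2.7 (2.66)–(2.67) and §2.8
(2.80): the hypotheses `(α)` (row/column sums) and `(κ)` (Gram constant) of the single-scale step
`hubbardSectorKernelNorm_effAction_le_of_sectorNorm` for the BGM covariance
`C' = S(F̃)ᵀ · normalCovariance(p) · S(F̃)` with `F̃ = bgmFatMultiplier`, `p = bgmCovSymbol` (`HubbardSectorCovariance`)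
rest on the bounds of `SectorProductSymbolDecay` for the character sums `S_{ω''ω₁ω₂}(z)` of the product symbols
`σ_{ω''} ζ̃_{ω₁} ζ̃_{ω₂}`.  This file makes the connection:

* **`norm_bgmSectorCovariance_entry_le`** — for `Y = (x, ((ω,σ),c))`, `Y' = (y, ((ω',σ'),c'))`,
  `‖C'(Y,Y')‖ ≤ (βL²)⁻¹ Σ_{ω₁ ∈ A(ω)} Σ_{ω₂ ∈ A(ω')} Σ_{ω''<N} (‖S_{ω''ω₁ω₂}(x - y)‖ + ‖S_{ω''ω₁ω₂}(y - x)‖)`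
  with `A(ω)` the sectors adjacent to `ω` and `S` LITERALLY the sums of `torusSectorProductSum_bounds`
  (`sampledPoint_eq`: the sampled frequency–momentum point is `(ω_{k₀}, 2πk̃/L)`).

Everything is proved; no definitions, no named facts.

## Sources

G. Benfatto, A. Giuliani, V. Mastropietro, Ann. Henri Poincaré 7 (2006) 809–898, §2.7 (2.66)–(2.67), §2.8 (2.80)
(`BenfattoGiulianiMastropietro2006`).
-/

noncomputable section

open Real Set Finset Literature.Probability.LatticeModels

namespace Literature.MathematicalPhysics.QuantumLattice

/-! ### The entries of the sectorised covariance -/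

section Entry

variable {L M : ℕ} [NeZero L] [NeZero M]

/-- Pulling a finite sum of symbols out of a character sum. [folklore] -/
theorem sum_smul_sum_comm {Q ι : Type*} [Fintype Q] (χ : Q → ℂ) (s : Finset ι) (f : ι → Q → ℂ) :
    ∑ q, χ q • ∑ i ∈ s, f i q = ∑ i ∈ s, ∑ q, χ q • f i q := by
  simp only [smul_sum]
  exact sum_comm

/-- The sampled frequency–momentum point of a product-torus label. [folklore] -/
theorem sampledPoint_eq (β : ℝ) (q : TorusSite 1 (2 * M) × TorusSite 2 L) :
    ((matsubaraFreq β M (⟨(q.1 0).val, ZMod.val_lt (q.1 0)⟩ : MatsubaraIdx M), torusCentredMomentum L q.2) : ℝ × (Fin 2 → ℝ)) =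
      (π * (1 - 2 * M) / β + 2 * π / β * (((q.1 0).val : ℕ) : ℝ), fun j => 2 * π / L * (((q.2 j).valMinAbs : ℤ) : ℝ)) := by
  rw [torusCentredMomentum_eq_valMinAbs]
  congr 1
  simp only [matsubaraFreq, matsubaraInt]
  push_cast
  ring

open Classical in
/-- **The entries of the sectorised single-scale covariance are product-symbol character sums**: for
`Y = (x, ((ω,σ),c))`, `Y' = (y, ((ω',σ'),c'))`,
`‖C'(Y,Y')‖ ≤ (βL²)⁻¹ Σ_{ω₁ ∈ A(ω)} Σ_{ω₂ ∈ A(ω')} Σ_{ω''<N} (‖S_{ω''ω₁ω₂}(x-y)‖ + ‖S_{ω''ω₁ω₂}(y-x)‖)`, where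
`A(ω)` are the (at most three) sectors adjacent to `ω` and `S_{ω''ω₁ω₂}(z) = Σ_q χ_q(z) σ_{ω''}(q) ζ̃_{ω₁}(θ_q) ζ̃_{ω₂}(θ_q)`
are the character sums bounded by `torusSectorProductSum_bounds`. [cite: BenfattoGiulianiMastropietro2006, §2.7 (2.66)–(2.67)] -/
theorem norm_bgmSectorCovariance_entry_le {e₀ : ℝ} (he : 0 < e₀) (μ : ℝ) {β : ℝ} (hβ : 0 < β) (n : ℕ)
    (Y Y' : SpaceTimeIdx L M × SectorLeg (sectorCount n)) :
    ‖((sectorSubMatrix L M β (bgmFatMultiplier L M e₀ β (bgmBand L μ) n)).transpose *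
        normalCovariance L M (bgmCovSymbol L M e₀ μ β n) *
        sectorSubMatrix L M β (bgmFatMultiplier L M e₀ β (bgmBand L μ) n)) Y Y'‖ ≤
      1 / (β * (L : ℝ) ^ 2) *
        ∑ ω₁ ∈ (range (sectorCount n)).filter
          (fun ω₁ : ℕ => ∃ δ : ℤ, |δ| ≤ 1 ∧ (sectorCount n : ℤ) ∣ ((ω₁ : ℤ) - ((Y.2.1.1 : ℕ) : ℤ) - δ)),
        ∑ ω₂ ∈ (range (sectorCount n)).filter
          (fun ω₂ : ℕ => ∃ δ : ℤ, |δ| ≤ 1 ∧ (sectorCount n : ℤ) ∣ ((ω₂ : ℤ) - ((Y'.2.1.1 : ℕ) : ℤ) - δ)),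
        ∑ ω'' ∈ range (sectorCount n),
          (‖∑ q : TorusSite 1 (2 * M) × TorusSite 2 L,
              (torusChar q.1 (fun _ : Fin 1 => ((Y.1.1 : ℕ) : ZMod (2 * M)) - ((Y'.1.1 : ℕ) : ZMod (2 * M))) *
                  torusChar q.2 (Y.1.2 - Y'.1.2)) •
                (sectorSymbol e₀ μ n ω'' (π * (1 - 2 * M) / β + 2 * π / β * (((q.1 0).val : ℕ) : ℝ),
                    fun j => 2 * π / L * (((q.2 j).valMinAbs : ℤ) : ℝ)) *
                  ((sectorWeightCirc n ω₁ (polarAngle fun j => 2 * π / L * (((q.2 j).valMinAbs : ℤ) : ℝ)) *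
                    sectorWeightCirc n ω₂ (polarAngle fun j => 2 * π / L * (((q.2 j).valMinAbs : ℤ) : ℝ)) : ℝ) : ℂ))‖ +
            ‖∑ q : TorusSite 1 (2 * M) × TorusSite 2 L,
              (torusChar q.1 (fun _ : Fin 1 => ((Y'.1.1 : ℕ) : ZMod (2 * M)) - ((Y.1.1 : ℕ) : ZMod (2 * M))) *
                  torusChar q.2 (Y'.1.2 - Y.1.2)) •
                (sectorSymbol e₀ μ n ω'' (π * (1 - 2 * M) / β + 2 * π / β * (((q.1 0).val : ℕ) : ℝ),
                    fun j => 2 * π / L * (((q.2 j).valMinAbs : ℤ) : ℝ)) *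
                  ((sectorWeightCirc n ω₁ (polarAngle fun j => 2 * π / L * (((q.2 j).valMinAbs : ℤ) : ℝ)) *
                    sectorWeightCirc n ω₂ (polarAngle fun j => 2 * π / L * (((q.2 j).valMinAbs : ℤ) : ℝ)) : ℝ) : ℂ))‖) := by
  have hL : (0 : ℝ) < L := Nat.cast_pos.2 (Nat.pos_of_ne_zero (NeZero.ne L))
  have hβL : β * (L : ℝ) ^ 2 ≠ 0 := by positivity
  -- the symbol of the entry, rewritten as `(βL²)⁻¹ Σ_{ω₁ ω₂ ω''} σ_{ω''} ζ̃_{ω₁} ζ̃_{ω₂}` at the sampled point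
  have hG : ∀ q : TorusSite 1 (2 * M) × TorusSite 2 L,
      (((1 / (β * (L : ℝ) ^ 2) : ℝ) : ℂ) ^ 2 *
        (bgmFatMultiplier L M e₀ β (bgmBand L μ) n Y.2.1.1 (⟨(q.1 0).val, ZMod.val_lt (q.1 0)⟩, q.2) *
          bgmFatMultiplier L M e₀ β (bgmBand L μ) n Y'.2.1.1 (⟨(q.1 0).val, ZMod.val_lt (q.1 0)⟩, q.2) *
            bgmCovSymbol L M e₀ μ β n ((⟨(q.1 0).val, ZMod.val_lt (q.1 0)⟩, q.2), Y.2.1.2))) =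
      (((1 / (β * (L : ℝ) ^ 2) : ℝ) : ℂ)) *
        ∑ ω₁ ∈ (range (sectorCount n)).filter
          (fun ω₁ : ℕ => ∃ δ : ℤ, |δ| ≤ 1 ∧ (sectorCount n : ℤ) ∣ ((ω₁ : ℤ) - ((Y.2.1.1 : ℕ) : ℤ) - δ)),
        ∑ ω₂ ∈ (range (sectorCount n)).filter
          (fun ω₂ : ℕ => ∃ δ : ℤ, |δ| ≤ 1 ∧ (sectorCount n : ℤ) ∣ ((ω₂ : ℤ) - ((Y'.2.1.1 : ℕ) : ℤ) - δ)),
        ∑ ω'' ∈ range (sectorCount n),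
          sectorSymbol e₀ μ n ω'' (π * (1 - 2 * M) / β + 2 * π / β * (((q.1 0).val : ℕ) : ℝ),
              fun j => 2 * π / L * (((q.2 j).valMinAbs : ℤ) : ℝ)) *
            ((sectorWeightCirc n ω₁ (polarAngle fun j => 2 * π / L * (((q.2 j).valMinAbs : ℤ) : ℝ)) *
              sectorWeightCirc n ω₂ (polarAngle fun j => 2 * π / L * (((q.2 j).valMinAbs : ℤ) : ℝ)) : ℝ) : ℂ) := by
    intro q
    rw [bgmFatMultiplier_mul_mul_bgmCovSymbol he, ← sampledPoint_eq β q]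
    rw [show momentumAngle L q.2 = polarAngle (fun j => 2 * π / L * (((q.2 j).valMinAbs : ℤ) : ℝ)) by
      rw [momentumAngle, torusCentredMomentum_eq_valMinAbs]]
    -- scalars: `(βL²)⁻² βL² = (βL²)⁻¹`
    rw [← mul_assoc, ← mul_assoc, show (((1 / (β * (L : ℝ) ^ 2) : ℝ) : ℂ)) ^ 2 * (((β * (L : ℝ) ^ 2 : ℝ) : ℂ)) =
      (((1 / (β * (L : ℝ) ^ 2) : ℝ) : ℂ)) by
        rw [← Complex.ofReal_pow, ← Complex.ofReal_mul]; congr 1; field_simp]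
    rw [mul_assoc]
    congr 1
    -- expand the product of the two angular plateaux and distribute
    push_cast
    rw [sum_mul_sum, sum_mul]
    refine sum_congr rfl fun ω₁ _ => ?_
    rw [sum_mul]
    refine sum_congr rfl fun ω₂ _ => ?_
    rw [mul_sum]
    refine sum_congr rfl fun ω'' _ => ?_
    ring
  -- the two orientations
  have key : ∀ (χ : TorusSite 1 (2 * M) × TorusSite 2 L → ℂ),
      ‖∑ q, χ q • (((1 / (β * (L : ℝ) ^ 2) : ℝ) : ℂ) ^ 2 *
        (bgmFatMultiplier L M e₀ β (bgmBand L μ) n Y.2.1.1 (⟨(q.1 0).val, ZMod.val_lt (q.1 0)⟩, q.2) *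
          bgmFatMultiplier L M e₀ β (bgmBand L μ) n Y'.2.1.1 (⟨(q.1 0).val, ZMod.val_lt (q.1 0)⟩, q.2) *
            bgmCovSymbol L M e₀ μ β n ((⟨(q.1 0).val, ZMod.val_lt (q.1 0)⟩, q.2), Y.2.1.2)))‖ ≤
      1 / (β * (L : ℝ) ^ 2) *
        ∑ ω₁ ∈ (range (sectorCount n)).filter
          (fun ω₁ : ℕ => ∃ δ : ℤ, |δ| ≤ 1 ∧ (sectorCount n : ℤ) ∣ ((ω₁ : ℤ) - ((Y.2.1.1 : ℕ) : ℤ) - δ)),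
        ∑ ω₂ ∈ (range (sectorCount n)).filter
          (fun ω₂ : ℕ => ∃ δ : ℤ, |δ| ≤ 1 ∧ (sectorCount n : ℤ) ∣ ((ω₂ : ℤ) - ((Y'.2.1.1 : ℕ) : ℤ) - δ)),
        ∑ ω'' ∈ range (sectorCount n),
          ‖∑ q : TorusSite 1 (2 * M) × TorusSite 2 L, χ q •
            (sectorSymbol e₀ μ n ω'' (π * (1 - 2 * M) / β + 2 * π / β * (((q.1 0).val : ℕ) : ℝ),
                fun j => 2 * π / L * (((q.2 j).valMinAbs : ℤ) : ℝ)) *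
              ((sectorWeightCirc n ω₁ (polarAngle fun j => 2 * π / L * (((q.2 j).valMinAbs : ℤ) : ℝ)) *
                sectorWeightCirc n ω₂ (polarAngle fun j => 2 * π / L * (((q.2 j).valMinAbs : ℤ) : ℝ)) : ℝ) : ℂ))‖ := by
    intro χ
    simp_rw [hG]
    simp_rw [smul_eq_mul, mul_left_comm (χ _) (((1 / (β * (L : ℝ) ^ 2) : ℝ) : ℂ)), ← smul_eq_mul (χ _)]
    rw [← mul_sum, norm_mul, Complex.norm_real, Real.norm_of_nonneg (by positivity)]
    refine mul_le_mul_of_nonneg_left ?_ (by positivity)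
    simp_rw [sum_smul_sum_comm]
    refine (norm_sum_le _ _).trans (sum_le_sum fun ω₁ _ => ?_)
    refine (norm_sum_le _ _).trans (sum_le_sum fun ω₂ _ => ?_)
    exact norm_sum_le _ _
  have h := norm_pullback_normalCovariance_le hβ.ne' (bgmFatMultiplier L M e₀ β (bgmBand L μ) n)
    (bgmCovSymbol L M e₀ μ β n) Y Y'
  refine h.trans ?_
  have h1 := key fun q => torusChar q.1 (fun _ : Fin 1 => ((Y.1.1 : ℕ) : ZMod (2 * M)) - ((Y'.1.1 : ℕ) : ZMod (2 * M))) *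
    torusChar q.2 (Y.1.2 - Y'.1.2)
  have h2 := key fun q => torusChar q.1 (fun _ : Fin 1 => ((Y'.1.1 : ℕ) : ZMod (2 * M)) - ((Y.1.1 : ℕ) : ZMod (2 * M))) *
    torusChar q.2 (Y'.1.2 - Y.1.2)
  refine (add_le_add h1 h2).trans (le_of_eq ?_)
  rw [← mul_add, ← sum_add_distrib]
  congr 1
  refine sum_congr rfl fun ω₁ _ => ?_
  rw [← sum_add_distrib]
  refine sum_congr rfl fun ω₂ _ => ?_
  rw [← sum_add_distrib]

end Entry

end Literature.MathematicalPhysics.QuantumLattice
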